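import Summits.QuantumFields.YangMills.Theses.ParabolicTrajectory
import Summits.QuantumFields.YangMills.Theorems.TunedSequenceExists.Negative.Glue
import Literature.MathematicalPhysics.QuantumFieldTheory.LatticeGaugeProofs
import Literature.Probability.Moments.TotalCovarianceCondExp

/-!
# Line `block-conditioned-covariance` — skeleton for crux `ParabolicTrajectory.TunedSequenceExists`
(stmt-QuantumFields-10524), crux-plan round 1; LEAD c2 revision (2026-08-16): `stub_totalCovariance` is now
PROVED (one line, from the landed `Literature.Probability.Moments.total_covariance_lower_bound_condExp`,
p101819), the composition is parametrised by the statement of the one remaining stub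
(`Registered.stub_conditionalWindow`), and § Certificate at the end shows, kernel-checked, that this
remaining stub ALONE implies the crux's open core `CorrelatorWindowLowerBound r M` for every compact simple
`G`, faithful `r`, `M ≥ 2` (`lowerBound_of_stub_conditionalWindow`) — it is crux-sized, not a sub-crux
obligation (lead notes: its admissible degenerate instance `V := const 1` is exactly the all-volume window
lower bound + the UV-side bound).

**Idea** (`Cruxes/TunedSequenceExists/Ideas/block-conditioned-covariance.md`): condition, don't
integrate. The correlator lower bound behind (S) is an ULTRAVIOLET statement: by the law of total
covariance over a block-averaged gauge field `V` at ONE scale `L_b = (K+1)·Mⁿ` above the separation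
`D = Mⁿ`, `Cov(P₀,P_D) = E[Cov(P₀,P_D | V)] + Cov(E[P₀|V], E[P_D|V])`; the compactness of `G` caps
what any block field can impose on a dimension-4 scalar (conditional means move by `≤ C·L_b⁻⁴`, for
EVERY `V`), and the conditional covariance is a two-gluon exchange in a MASSIVE, weakly coupled
fluctuation integral (`≥ θ₁·D⁻⁸` at the asymptotic-freedom window coupling `β_w(n) → ∞`). The
infrared law of `V` is never used.

**Composition** (`TunedSequenceExists_of`, kernel-checked, A12 shape — concludes the crux BY NAME, no
hypotheses; its only gaps are the two registered stubs it calls):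
`stub_conditionalWindow` (conditional window package at `β_w(n)` on every odd torus `2L+1`,
`L ≥ L₁(n)`, plus the UV-side a-priori bound for all `β ≥ β_w(n)`) and `stub_totalCovariance` (law
of total covariance, elementary) give the finite-volume window lower bound
`θ₁ - C² ≤ (Mⁿ)⁸ ⟨P ; τ_{Mⁿ} P⟩_{β_w, 2L+1}` (`lower_of_package`); exact tuning by the IVT
(landed `Negative.Glue.exists_ge_corr_eq`, whose freezing endpoint is
`Negative.Freezing.latticeConnectedCorr_curvature_tendsto_zero`) at a coupling `β_k ≥ β_w(n_k) ≥ k`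
on the torus `2(L₁ + k·M^{n_k})+1` builds an `M`-adic scheme with `N_1(k) = θ` exactly, the UV-side
bound makes every `N_t`, `t ≥ 2`, bounded along it (`windowBdd_of_stubs`), and the diagonal
extraction of the standing Disproof.lean § ClauseThree (`window_of_windowBdd`, copied here with its
`reindex`) upgrades bounded to convergent: `Window r M`, i.e. the crux body (`Iff.rfl` unfolding).

**Disproof.lean used** (cdisprove gen 3, § Targets empty — no `_false_without_` theorem exists):
§ Glue (`CorrelatorWindowLowerBound` is exactly what `lower_of_package` outputs, quantifier order
`∀ B, ∀ᶠ n` = warning (2)); § ClauseThree (clause (iii) costs an a-priori bound on `N_t`, `t ≥ 2`: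
supplied here by the UV-side clause of `stub_conditionalWindow`, NOT by reflection positivity —
`CorrMonotoneNonneg` is the documented alternative); § Ceiling / § LoadBearing respected (`β_w(n)` is
a tuned divergence; `2 ≤ M` and simplicity of `G` are hypotheses of the stubs); landed
`Negative.Glue` / `Negative.Freezing` / `Negative.AtZeroFalse` imported and used.
-/

set_option autoImplicit false

noncomputable section

namespace Summit.QuantumFields.YangMills.Cruxes.TunedSequenceExists.BlockConditionedCovariance

open Filter Topology MeasureTheory
open Literature.MathematicalPhysics.QuantumFieldTheory Literature.MathematicalPhysics.QuantumLattice
open Summit.QuantumFields.YangMills.Theses.ParabolicTrajectory (TunedSequenceExists)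
open Summit.QuantumFields.YangMills.Theorems.TunedSequenceExists.Negative.Glue (exists_ge_corr_eq)

/-! ## Statements (local `Prop` packages over tree declarations only) -/

section Defs

/-- **Law of total covariance, lower form** (glue of the idea card, verbatim `Sketch.TotalCovarianceLowerBound`
of `Cruxes/TunedSequenceExists/SketchK1.lean`; PROVED sorry-free by triage r1-1, evidence `TotalCov.lean` on the
item): on a probability space, if the conditional covariance of bounded measurable `f, g` given a sub-σ-algebra
`m ≤ m₀` is a.s. `≥ θ` and the conditional means are a.s. within `ε₁, ε₂` of constants, then
`Cov(f, g) ≥ θ - ε₁ ε₂` (law of total covariance `integral_condExp`, Popoviciu `Var ≤ ε²`, Cauchy–Schwarz). -/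
def TotalCovarianceLowerBound : Prop :=
  ∀ (Ω : Type) (m m₀ : MeasurableSpace Ω) (μ : Measure Ω) [IsProbabilityMeasure μ] (f g : Ω → ℝ)
    (θ ε₁ ε₂ a b Cf Cg : ℝ), m ≤ m₀ → Measurable f → Measurable g → (∀ ω, |f ω| ≤ Cf) →
    (∀ ω, |g ω| ≤ Cg) →
    (∀ᵐ ω ∂μ, θ ≤ (μ[f * g|m]) ω - (μ[f|m]) ω * (μ[g|m]) ω) →
    (∀ᵐ ω ∂μ, |(μ[f|m]) ω - a| ≤ ε₁) → (∀ᵐ ω ∂μ, |(μ[g|m]) ω - b| ≤ ε₂) →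
      θ - ε₁ * ε₂ ≤ ∫ ω, f ω * g ω ∂μ - (∫ ω, f ω ∂μ) * ∫ ω, g ω ∂μ

variable {G : Type} [Group G] [TopologicalSpace G] [IsTopologicalGroup G] [CompactSpace G]
  [MeasurableSpace G] [BorelSpace G]

/-- **The conditional window package** at block depth `n`, coupling `βw`, on the odd torus of side `2L+1`
(constants `θ₁`, `C`): there is a coarse-graining of the fine gauge field — a measurable, gauge-COVARIANT map
`V` to gauge fields on a coarse torus of side `Sc` (blocks represented by `rep`; intended: the composite of
Bałaban's one-step gauge-covariant block AVERAGES up to block side `(K+1)·Mⁿ`, with one defect row of blocks so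
that odd sides are served — NOT the straight-line decimation `GaugeBlockAveraging.axial`, triage S2) — such that,
with `m = σ(V)`, `P₀ = P ∘ torusLift`, `P_D = P ∘ τ_{Mⁿ e₀} ∘ torusLift` (`P = r.curvature.F`, the Wilson action
density) under `wilsonMeasure r.ρ βw`:
(i) a.s. in `V` the conditional covariance of `P₀, P_D` is `≥ θ₁ · M^{-8n}` (two-gluon exchange in the massive,
weakly coupled fluctuation integral given `V`), and
(ii) a.s. in `V` both conditional means lie within `C · M^{-4n}` of constants (the compactness cap: every block
field is realised by a fine field of curvature `≤ π/L_b²`, `L_b = (K+1)Mⁿ`, and `C` absorbs `(K+1)⁻⁴`; for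
non-simply-connected `G` the coarse field also carries discrete `π₁(G)`-monopole parities that NO smooth fine field
realises — the cap is asked only at the two insertion sites `0`, `Mⁿe₀`, which the intended blocking places deep inside
blocks, see the line card § Barriers). The package is used ONLY through `stub_totalCovariance` (`lower_of_package`). -/
def CondWindowPackage (r : LatticeRep G) (M n L : ℕ) (βw θ₁ C : ℝ) : Prop :=
  ∃ (Sc : ℕ) (V : GaugeConfig 4 (2 * L + 1) G → GaugeConfig 4 Sc G) (rep : Site 4 Sc → Site 4 (2 * L + 1)),
    Measurable V ∧
    (∀ (g : Site 4 (2 * L + 1) → G) (U : GaugeConfig 4 (2 * L + 1) G),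
      V (gaugeTransform g U) = gaugeTransform (g ∘ rep) (V U)) ∧
    (∀ᵐ U ∂(wilsonMeasure (d := 4) (L := 2 * L + 1) r.ρ βw),
      θ₁ * ((M : ℝ) ^ n)⁻¹ ^ 8 ≤
        ((wilsonMeasure (d := 4) (L := 2 * L + 1) r.ρ βw)[
            (fun W : GaugeConfig 4 (2 * L + 1) G => r.curvature.F (torusLift (2 * L + 1) W)) *
              (fun W : GaugeConfig 4 (2 * L + 1) G => r.curvature.F
                (configShift (-Pi.single 0 ((M ^ n : ℕ) : ℤ)) (torusLift (2 * L + 1) W)))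
            | MeasurableSpace.comap V inferInstance]) U -
          ((wilsonMeasure (d := 4) (L := 2 * L + 1) r.ρ βw)[
              (fun W : GaugeConfig 4 (2 * L + 1) G => r.curvature.F (torusLift (2 * L + 1) W))
              | MeasurableSpace.comap V inferInstance]) U *
            ((wilsonMeasure (d := 4) (L := 2 * L + 1) r.ρ βw)[
                (fun W : GaugeConfig 4 (2 * L + 1) G => r.curvature.F
                  (configShift (-Pi.single 0 ((M ^ n : ℕ) : ℤ)) (torusLift (2 * L + 1) W)))
                | MeasurableSpace.comap V inferInstance]) U) ∧
    ∃ a a' : ℝ,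
      (∀ᵐ U ∂(wilsonMeasure (d := 4) (L := 2 * L + 1) r.ρ βw),
        |((wilsonMeasure (d := 4) (L := 2 * L + 1) r.ρ βw)[
              (fun W : GaugeConfig 4 (2 * L + 1) G => r.curvature.F (torusLift (2 * L + 1) W))
              | MeasurableSpace.comap V inferInstance]) U - a| ≤ C * ((M : ℝ) ^ n)⁻¹ ^ 4) ∧
      (∀ᵐ U ∂(wilsonMeasure (d := 4) (L := 2 * L + 1) r.ρ βw),
        |((wilsonMeasure (d := 4) (L := 2 * L + 1) r.ρ βw)[
              (fun W : GaugeConfig 4 (2 * L + 1) G => r.curvature.F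
                (configShift (-Pi.single 0 ((M ^ n : ℕ) : ℤ)) (torusLift (2 * L + 1) W)))
              | MeasurableSpace.comap V inferInstance]) U - a'| ≤ C * ((M : ℝ) ^ n)⁻¹ ^ 4)

/-- **The UV-side a-priori bound** at block depth `n` on the odd torus of side `2L+1`: for every coupling
`β ≥ βw` (the ultraviolet side of the window: running coupling at scale `Mⁿ` at most `g*`) and every separation
`t · Mⁿ`, `2 ≤ t`, that fits in the half torus, the rescaled curvature correlator is bounded by `C₃` —
canonical scaling of the dimension-4 operator `tr F²` from ABOVE (the two-sided form of the same conditional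
estimate + the means cap beyond the block scale; this is what clause (iii) of the crux costs, Disproof.lean
§ ClauseThree `AprioriBound`, obtained WITHOUT reflection positivity). -/
def UVSideBound (r : LatticeRep G) (M n L : ℕ) (βw C₃ : ℝ) : Prop :=
  ∀ β : ℝ, βw ≤ β → ∀ t : ℕ, 2 ≤ t → t * M ^ n ≤ L →
    |((M : ℝ) ^ n) ^ 8 *
        latticeConnectedCorr r.ρ β (2 * L + 1) r.curvature.F r.curvature.F (t * M ^ n)| ≤ C₃

end Defs

/-! ## The registered stubs -/

namespace Registered

/-- Alias of the statement of `stub_conditionalWindow`, keyed by the registered stub name (taken as the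
hypothesis of the parametrised composition `window_of_stub` and of the certificate
`lowerBound_of_stub_conditionalWindow`; `TunedSequenceExists_of` instantiates it with the stub). -/
abbrev stub_conditionalWindow : Prop :=
  ∀ (G : Type) [Group G] [TopologicalSpace G] [IsTopologicalGroup G] [CompactSpace G]
    [MeasurableSpace G] [BorelSpace G], IsCompactSimpleLieGroup G →
    ∀ (r : LatticeRep G) (M : ℕ), 2 ≤ M →
      ∃ θ₁ C C₃ : ℝ, C ^ 2 < θ₁ ∧
        ∀ B : ℝ, ∀ᶠ n : ℕ in atTop, ∃ βw : ℝ, B ≤ βw ∧ ∃ L₁ : ℕ, ∀ L : ℕ, L₁ ≤ L →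
          CondWindowPackage r M n L βw θ₁ C ∧ UVSideBound r M n L βw C₃

end Registered


/-- **stub_totalCovariance** (size M, elementary) — PROVED (lead c2): the law of total covariance in
lower-bound form, from the landed Literature theorem
`Literature.Probability.Moments.total_covariance_lower_bound_condExp` (p101819; its statement needs no
measurability/boundedness of `f, g`, so the stub's extra hypotheses are simply dropped). -/
theorem stub_totalCovariance : TotalCovarianceLowerBound := by
  intro Ω m m₀ μ _ f g θ ε₁ ε₂ a b Cf Cg hm _ _ _ _ hcov ha hb
  exact Literature.Probability.Moments.total_covariance_lower_bound_condExp hm hcov ha hb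

/-- **stub_conditionalWindow** (THE LOAD-BEARING STUB, size L/open-adjacent; Bałaban-class conditional
analysis with two local insertions, uniform in the block field): for every compact simple `G`, faithful unitary
`r` and `M ≥ 2` there are `θ₁ > C² ≥ 0` and `C₃` such that for every floor `B`, for all large block depths `n`,
SOME coupling `βw ≥ B` (intended: the bare coupling whose running coupling at the block scale `(K+1)Mⁿ` equals a
fixed small `g*`; asymptotic freedom `b₀(G) > 0` puts it at `βw ≍ κ_r(g*⁻² + 2b₀ log((K+1)Mⁿ)) → ∞` — triage S1:
`∀ B, ∀ᶠ n, ∃ βw ≥ B`, never a floor `n ≤ βw`) satisfies, on EVERY odd torus `2L+1` with `L ≥ L₁(n)`: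
the conditional window package `CondWindowPackage r M n L βw θ₁ C` (clauses (i), (ii): the card's C⁺ with the
triage repairs S1/S2, odd sides and the constants clause `C² < θ₁`), and the UV-side a-priori bound
`UVSideBound r M n L βw C₃` for all `β ≥ βw`. For `U(1)` no such window exists (`b₀ = 0`): the stub uses the
non-abelian structure exactly at the choice of `βw`. -/
theorem stub_conditionalWindow :
    ∀ (G : Type) [Group G] [TopologicalSpace G] [IsTopologicalGroup G] [CompactSpace G]
      [MeasurableSpace G] [BorelSpace G], IsCompactSimpleLieGroup G →
      ∀ (r : LatticeRep G) (M : ℕ), 2 ≤ M →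
        ∃ θ₁ C C₃ : ℝ, C ^ 2 < θ₁ ∧
          ∀ B : ℝ, ∀ᶠ n : ℕ in atTop, ∃ βw : ℝ, B ≤ βw ∧ ∃ L₁ : ℕ, ∀ L : ℕ, L₁ ≤ L →
            CondWindowPackage r M n L βw θ₁ C ∧ UVSideBound r M n L βw C₃ := by
  sorry

/-! ## Glue, proved -/

section Glue

variable {ι : Type}

-- adapted from the standing `Cruxes/TunedSequenceExists/Disproof.lean` § ClauseThree (cdisprove gens 2–3)
/-- Re-indexing a scaling scheme along a strictly increasing map `φ : ℕ → ℕ`. -/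
def reindex (sch : SpeciesScheme ι) (φ : ℕ → ℕ) (hφ : StrictMono φ) : SpeciesScheme ι where
  a := sch.a ∘ φ
  a_pos k := sch.a_pos (φ k)
  tendsto_a := sch.tendsto_a.comp hφ.tendsto_atTop
  β := sch.β ∘ φ
  L := sch.L ∘ φ
  tendsto_L := sch.tendsto_L.comp hφ.tendsto_atTop
  c s := sch.c s ∘ φ
  m s := sch.m s ∘ φ

@[simp] theorem reindex_β (sch : SpeciesScheme ι) (φ : ℕ → ℕ) (hφ : StrictMono φ) (k : ℕ) :
    (reindex sch φ hφ).β k = sch.β (φ k) := rfl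

@[simp] theorem reindex_side (sch : SpeciesScheme ι) (φ : ℕ → ℕ) (hφ : StrictMono φ) (k : ℕ) :
    (reindex sch φ hφ).side k = sch.side (φ k) := rfl

/-- An eventually bounded real sequence is bounded. -/
theorem exists_bound_of_eventually {u : ℕ → ℝ} {C : ℝ} (h : ∀ᶠ k in atTop, |u k| ≤ C) :
    ∃ C' : ℝ, ∀ k, |u k| ≤ C' := by
  obtain ⟨K, hK⟩ := eventually_atTop.1 h
  refine ⟨max C (∑ j ∈ Finset.range K, |u j|), fun k => ?_⟩
  rcases lt_or_ge k K with hk | hk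
  · exact le_max_of_le_right
      (Finset.single_le_sum (fun j _ => abs_nonneg (u j)) (Finset.mem_range.2 hk))
  · exact le_max_of_le_left (hK k hk)

variable {G : Type} [Group G] [TopologicalSpace G] [IsTopologicalGroup G] [CompactSpace G]
  [MeasurableSpace G] [BorelSpace G]

/-- The body of the crux at fixed `(G, r, M)` (verbatim; `TunedSequenceExists` is
`∀ G simple, ∀ r, ∀ M ≥ 2, Window r M` by `Iff.rfl`, cf. Disproof.lean `tunedSequenceExists_iff`). -/
def Window (r : LatticeRep G) (M : ℕ) : Prop :=
  ∃ θ₀ : ℝ, 0 < θ₀ ∧ ∀ θ : ℝ, 0 < θ → θ < θ₀ →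
    ∃ (sch : SpeciesScheme (YMSpecies G)) (n : ℕ → ℕ),
      (∀ k, sch.a k = ((M : ℝ) ^ n k)⁻¹) ∧ Tendsto sch.β atTop atTop ∧
      (∀ t : ℕ, 0 < t → ∃ c : ℝ, Tendsto (fun k => ((M : ℝ) ^ n k) ^ 8 *
          latticeConnectedCorr r.ρ (sch.β k) (sch.side k) r.curvature.F r.curvature.F
            (t * M ^ n k)) atTop (𝓝 c)) ∧
      Tendsto (fun k => ((M : ℝ) ^ n k) ^ 8 *
          latticeConnectedCorr r.ρ (sch.β k) (sch.side k) r.curvature.F r.curvature.F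
            (M ^ n k)) atTop (𝓝 θ)

/-- The crux body with clause (iii) weakened to BOUNDEDNESS of every `N_t` along the witness. -/
def WindowBdd (r : LatticeRep G) (M : ℕ) : Prop :=
  ∃ θ₀ : ℝ, 0 < θ₀ ∧ ∀ θ : ℝ, 0 < θ → θ < θ₀ →
    ∃ (sch : SpeciesScheme (YMSpecies G)) (n : ℕ → ℕ),
      (∀ k, sch.a k = ((M : ℝ) ^ n k)⁻¹) ∧ Tendsto sch.β atTop atTop ∧
      (∀ t : ℕ, 0 < t → ∃ C : ℝ, ∀ k, |((M : ℝ) ^ n k) ^ 8 *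
          latticeConnectedCorr r.ρ (sch.β k) (sch.side k) r.curvature.F r.curvature.F
            (t * M ^ n k)| ≤ C) ∧
      Tendsto (fun k => ((M : ℝ) ^ n k) ^ 8 *
          latticeConnectedCorr r.ρ (sch.β k) (sch.side k) r.curvature.F r.curvature.F
            (M ^ n k)) atTop (𝓝 θ)

-- adapted from `Cruxes/TunedSequenceExists/Disproof.lean` § ClauseThree `window_of_windowBdd`
/-- **Diagonal extraction**: a witness with bounded `N_t` (all `t ≥ 1`) has a re-indexing along which every
`N_t` converges; the re-indexed scheme is again an `M`-adic scheme with `β → ∞` and the same tuned limit. -/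
theorem window_of_windowBdd (r : LatticeRep G) (M : ℕ) (h : WindowBdd r M) : Window r M := by
  obtain ⟨θ₀, hθ₀, h⟩ := h
  refine ⟨θ₀, hθ₀, fun θ hθ hθ' => ?_⟩
  obtain ⟨sch, n, hshape, hβ, hbdd, hlim⟩ := h θ hθ hθ'
  set u : ℕ → ℕ → ℝ := fun k t' => ((M : ℝ) ^ n k) ^ 8 *
    latticeConnectedCorr r.ρ (sch.β k) (sch.side k) r.curvature.F r.curvature.F
      ((t' + 1) * M ^ n k) with hu
  choose C hC using fun t' : ℕ => hbdd (t' + 1) (Nat.succ_pos t')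
  set K : Set (ℕ → ℝ) := Set.pi Set.univ fun t' => Set.Icc (-C t') (C t') with hK
  have hKc : IsCompact K := isCompact_univ_pi fun t' => isCompact_Icc
  have huK : ∀ k, u k ∈ K := fun k => by
    simp only [hK, Set.mem_pi, Set.mem_univ, true_implies, Set.mem_Icc]
    intro t'
    exact abs_le.1 (hC t' k)
  obtain ⟨lim, -, φ, hφ, hconv⟩ := hKc.tendsto_subseq huK
  refine ⟨reindex sch φ hφ, n ∘ φ, fun k => hshape (φ k), hβ.comp hφ.tendsto_atTop, ?_, ?_⟩
  · intro t ht
    obtain ⟨t', rfl⟩ := Nat.exists_eq_succ_of_ne_zero ht.ne'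
    refine ⟨lim t', ?_⟩
    have h1 : Tendsto (fun j => u (φ j) t') atTop (𝓝 (lim t')) := tendsto_pi_nhds.1 hconv t'
    refine h1.congr fun j => ?_
    simp only [hu, Function.comp_apply, reindex_β, reindex_side, Nat.succ_eq_add_one]
  · exact hlim.comp hφ.tendsto_atTop

-- adapted from `Cruxes/HypercubicLimit/Disproof.lean` (`integral_configShift_torusLift`)
/-- **Translation invariance of the torus means**: shifting the observable on `ℤ⁴` before the periodic lift
does not change its Wilson expectation. -/
theorem integral_configShift_torusLift {N : ℕ} (ρ : G →* Matrix (Fin N) (Fin N) ℂ) (β : ℝ)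
    (L : ℕ) [NeZero L] (B : LGConfig 4 G → ℝ) (w : Literature.Probability.LatticeModels.Site 4) :
    ∫ U, B (configShift w (torusLift L U)) ∂(wilsonMeasure (d := 4) (L := L) ρ β) =
      ∫ U, B (torusLift L U) ∂(wilsonMeasure (d := 4) (L := L) ρ β) := by
  have h := wilsonExpectation_comp_torusConfigShift (d := 4) (L := L) ρ β
    (Literature.Probability.LatticeModels.Torus.proj L w) (toTorusObservable L B)
  rw [← toTorusObservable_comp_configShift] at h
  simpa [wilsonExpectation, toTorusObservable] using h

/-- **The Transfer, made formal**: the conditional window package plus the law of total covariance give the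
finite-volume window lower bound `θ₁ - C² ≤ (Mⁿ)⁸ ⟨P ; τ_{Mⁿ} P⟩_{βw, 2L+1}` (the exact shape of
Disproof.lean § Glue `CorrelatorWindowLowerBound`, per torus). -/
theorem lower_of_package (htc : TotalCovarianceLowerBound) (r : LatticeRep G) {M : ℕ} (hM : 2 ≤ M)
    (n L : ℕ) (βw θ₁ C : ℝ) (hpkg : CondWindowPackage r M n L βw θ₁ C) :
    θ₁ - C ^ 2 ≤ ((M : ℝ) ^ n) ^ 8 *
      latticeConnectedCorr r.ρ βw (2 * L + 1) r.curvature.F r.curvature.F (M ^ n) := by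
  obtain ⟨Sc, V, rep, hV, -, hcc, a, a', ha, ha'⟩ := hpkg
  haveI := isProbabilityMeasure_wilsonMeasure (d := 4) (L := 2 * L + 1) r.ρ r.continuous βw
  obtain ⟨Cf, hCf⟩ := r.curvature.bounded
  have hF : Measurable r.curvature.F := r.curvature.measurable
  have hf : Measurable (fun W : GaugeConfig 4 (2 * L + 1) G => r.curvature.F (torusLift (2 * L + 1) W)) :=
    hF.comp (measurable_torusLift _)
  have hg : Measurable (fun W : GaugeConfig 4 (2 * L + 1) G => r.curvature.F
      (configShift (-Pi.single 0 ((M ^ n : ℕ) : ℤ)) (torusLift (2 * L + 1) W))) :=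
    hF.comp ((configShift _).measurable.comp (measurable_torusLift _))
  have hm : MeasurableSpace.comap V (inferInstance : MeasurableSpace (GaugeConfig 4 Sc G)) ≤
      (inferInstance : MeasurableSpace (GaugeConfig 4 (2 * L + 1) G)) := hV.comap_le
  have key := htc (GaugeConfig 4 (2 * L + 1) G) (MeasurableSpace.comap V inferInstance) inferInstance
    (wilsonMeasure (d := 4) (L := 2 * L + 1) r.ρ βw)
    (fun W : GaugeConfig 4 (2 * L + 1) G => r.curvature.F (torusLift (2 * L + 1) W))
    (fun W : GaugeConfig 4 (2 * L + 1) G => r.curvature.F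
      (configShift (-Pi.single 0 ((M ^ n : ℕ) : ℤ)) (torusLift (2 * L + 1) W)))
    (θ₁ * ((M : ℝ) ^ n)⁻¹ ^ 8) (C * ((M : ℝ) ^ n)⁻¹ ^ 4) (C * ((M : ℝ) ^ n)⁻¹ ^ 4) a a' Cf Cf
    hm hf hg (fun W => hCf _) (fun W => hCf _) hcc ha ha'
  have hshift := integral_configShift_torusLift (G := G) r.ρ βw (2 * L + 1) r.curvature.F
    (-Pi.single 0 ((M ^ n : ℕ) : ℤ))
  have hcorr : latticeConnectedCorr r.ρ βw (2 * L + 1) r.curvature.F r.curvature.F (M ^ n) =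
      (∫ W, r.curvature.F (torusLift (2 * L + 1) W) *
          r.curvature.F (configShift (-Pi.single 0 ((M ^ n : ℕ) : ℤ)) (torusLift (2 * L + 1) W))
          ∂(wilsonMeasure (d := 4) (L := 2 * L + 1) r.ρ βw)) -
        (∫ W, r.curvature.F (torusLift (2 * L + 1) W) ∂(wilsonMeasure (d := 4) (L := 2 * L + 1) r.ρ βw)) *
          ∫ W, r.curvature.F (configShift (-Pi.single 0 ((M ^ n : ℕ) : ℤ)) (torusLift (2 * L + 1) W))
            ∂(wilsonMeasure (d := 4) (L := 2 * L + 1) r.ρ βw) := by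
    rw [hshift]
    rfl
  have hy : (0 : ℝ) < (M : ℝ) ^ n := by positivity
  have halg : ((M : ℝ) ^ n) ^ 8 * (θ₁ * ((M : ℝ) ^ n)⁻¹ ^ 8 - C * ((M : ℝ) ^ n)⁻¹ ^ 4 * (C * ((M : ℝ) ^ n)⁻¹ ^ 4)) =
      θ₁ - C ^ 2 := by
    field_simp
  rw [hcorr, ← halg]
  exact mul_le_mul_of_nonneg_left key (by positivity)

/-- **Bounded window from the stubs**: the `M`-adic scheme tuned EXACTLY (`N_1(k) = θ`) by the IVT on
`[β_w(n_k), ∞)` over the tori `2(L₁(n_k) + k·M^{n_k})+1`, with every `N_t`, `t ≥ 2`, bounded by the UV-side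
clause (eventually in `k`, hence everywhere). -/
theorem windowBdd_of_stubs (htc : TotalCovarianceLowerBound) (hcw : Registered.stub_conditionalWindow)
    (hG : IsCompactSimpleLieGroup G) (r : LatticeRep G) {M : ℕ} (hM : 2 ≤ M) : WindowBdd r M := by
  obtain ⟨θ₁, C, C₃, hCθ, hwin⟩ := hcw G hG r M hM
  refine ⟨θ₁ - C ^ 2, sub_pos.2 hCθ, fun θ hθ hθθ₀ => ?_⟩
  -- per-stage data: depth `n k ≥ k`, window coupling `βw k ≥ k`, torus floor `L₁ k`
  have hk := fun k : ℕ => ((hwin (k : ℝ)).and (eventually_ge_atTop k)).exists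
  choose n hn hkn using hk
  choose βw hβw L₁ hL₁ using hn
  have hpk : ∀ k : ℕ, CondWindowPackage r M (n k) (L₁ k + k * M ^ n k) (βw k) θ₁ C ∧
      UVSideBound r M (n k) (L₁ k + k * M ^ n k) (βw k) C₃ :=
    fun k => hL₁ k (L₁ k + k * M ^ n k) (Nat.le_add_right _ _)
  have hstar : ∀ k : ℕ, θ₁ - C ^ 2 ≤ ((M : ℝ) ^ n k) ^ 8 *
      latticeConnectedCorr r.ρ (βw k) (2 * (L₁ k + k * M ^ n k) + 1) r.curvature.F r.curvature.F
        (M ^ n k) :=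
    fun k => lower_of_package htc r hM (n k) (L₁ k + k * M ^ n k) (βw k) θ₁ C (hpk k).1
  -- exact tuning by the intermediate value theorem on `[βw k, ∞)` (continuity + freezing, landed glue)
  choose β hββw hβeq using fun k : ℕ => exists_ge_corr_eq r M (n k) (L₁ k + k * M ^ n k) hθ hθθ₀ (hstar k)
  have hM1 : (1 : ℝ) < M := by exact_mod_cast hM
  have hn_top : Tendsto n atTop atTop := tendsto_atTop_mono hkn tendsto_id
  have hpow_top : Tendsto (fun k => (M : ℝ) ^ n k) atTop atTop :=
    (tendsto_pow_atTop_atTop_of_one_lt hM1).comp hn_top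
  -- the scheme
  let sch : SpeciesScheme (YMSpecies G) :=
    { a := fun k => ((M : ℝ) ^ n k)⁻¹
      a_pos := fun k => by positivity
      tendsto_a := tendsto_inv_atTop_zero.comp hpow_top
      β := β
      L := fun k => L₁ k + k * M ^ n k
      tendsto_L := by
        refine tendsto_atTop_mono (fun k => ?_) tendsto_natCast_atTop_atTop
        have hLk : (k : ℝ) * (M : ℝ) ^ n k ≤ ((L₁ k + k * M ^ n k : ℕ) : ℝ) := by
          have : k * M ^ n k ≤ L₁ k + k * M ^ n k := Nat.le_add_left _ _
          exact_mod_cast this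
        have hp : (0 : ℝ) < (M : ℝ) ^ n k := by positivity
        show (k : ℝ) ≤ ((M : ℝ) ^ n k)⁻¹ * ((L₁ k + k * M ^ n k : ℕ) : ℝ)
        rw [inv_mul_eq_div, le_div_iff₀ hp]
        exact hLk
      c := fun _ _ => 0
      m := fun _ _ => 0 }
  refine ⟨sch, n, fun k => rfl, ?_, ?_, ?_⟩
  · -- `β_k ≥ βw k ≥ k → ∞`
    exact tendsto_atTop_mono (fun k => (hβw k).trans (hββw k)) tendsto_natCast_atTop_atTop
  · -- boundedness of every `N_t`
    intro t ht
    rcases Nat.lt_or_ge t 2 with ht2 | ht2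
    · obtain rfl : t = 1 := by omega
      refine ⟨|θ|, fun k => ?_⟩
      have h1 : ((M : ℝ) ^ n k) ^ 8 *
          latticeConnectedCorr r.ρ (sch.β k) (sch.side k) r.curvature.F r.curvature.F (1 * M ^ n k) = θ := by
        rw [one_mul]
        exact hβeq k
      rw [h1]
    · refine exists_bound_of_eventually (C := C₃) ?_
      filter_upwards [eventually_ge_atTop t] with k hk
      have hfit : t * M ^ n k ≤ L₁ k + k * M ^ n k :=
        (Nat.mul_le_mul_right _ hk).trans (Nat.le_add_left _ _)
      exact (hpk k).2 (β k) (hββw k) t ht2 hfit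
  · -- exact tuning
    exact tendsto_const_nhds.congr fun k => (hβeq k).symm

end Glue

/-! ## The composition (kernel-checked; `sorry` only inside the two stubs it invokes) -/

/-- **The line closes the crux** (A12 shape: concludes `ParabolicTrajectory.TunedSequenceExists` BY NAME, no
hypotheses; the only gaps are the registered stubs `stub_conditionalWindow`, `stub_totalCovariance` it calls):
for every compact simple `G`, faithful unitary `r`, `M ≥ 2`, the bounded window (`windowBdd_of_stubs`)
upgrades to the crux body by diagonal extraction (`window_of_windowBdd`). With the stubs replaced by hypotheses
of the same statements it checks with axioms `propext, Classical.choice, Quot.sound` only. -/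
theorem TunedSequenceExists_of : TunedSequenceExists := by
  intro G _ _ _ _ hG
  letI : MeasurableSpace G := borel G
  haveI : BorelSpace G := ⟨rfl⟩
  intro r M hM
  show Window r M
  exact window_of_windowBdd r M (windowBdd_of_stubs stub_totalCovariance stub_conditionalWindow hG r hM)

/-! ## § Certificate (lead c2, 2026-08-16): the remaining stub is crux-sized

`stub_conditionalWindow` ALONE (the law of total covariance being a theorem now) implies the crux's open
core — the finite-volume correlator window lower bound of the standing Disproof § Glue — for every compact
simple `G`, faithful unitary `r` and `M ≥ 2`, through the landed `Negative.Glue.lowerBound_of_weak`.  Hence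
no reshape of this skeleton can register a stub below the crux's open input: the line adds the law of
total covariance to the crux and nothing else (its admissible degenerate instance `V := const 1` (the identity
configuration), `rep := const` — measurable, covariant since conjugating the identity configuration by a
constant gauge function does nothing, `comap V = ⊥` so that `μ[·|⊥]` is the mean — turns clause (i) of `CondWindowPackage`
into the all-volume bound `θ₁ M^{-8n} ≤ Cov_{βw, 2L+1}(P₀, P_D)` for all `L ≥ L₁(n)` and clause (ii) into a
tautology). -/

/-- **Crux-sizedness certificate.** The statement of `stub_conditionalWindow` implies
`CorrelatorWindowLowerBound r M` (verbatim body of `Negative.Glue.lowerBound_of_weak`'s conclusion) for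
every admissible datum. -/
theorem lowerBound_of_stub_conditionalWindow (hcw : Registered.stub_conditionalWindow)
    (G : Type) [Group G] [TopologicalSpace G] [IsTopologicalGroup G] [CompactSpace G]
    (hG : IsCompactSimpleLieGroup G) :
    letI : MeasurableSpace G := borel G
    haveI : BorelSpace G := ⟨rfl⟩
    ∀ (r : LatticeRep G) (M : ℕ), 2 ≤ M →
      ∃ θ₀ : ℝ, 0 < θ₀ ∧ ∀ (B : ℝ) (m₀ L₀ : ℕ), ∃ m : ℕ, m₀ ≤ m ∧ ∃ L : ℕ, L₀ * M ^ m ≤ L ∧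
        ∃ β : ℝ, B ≤ β ∧ θ₀ ≤ ((M : ℝ) ^ m) ^ 8 *
          latticeConnectedCorr r.ρ β (2 * L + 1) r.curvature.F r.curvature.F (M ^ m) := by
  letI : MeasurableSpace G := borel G
  haveI : BorelSpace G := ⟨rfl⟩
  intro r M hM
  obtain ⟨θ₀, hθ₀, hw⟩ :=
    window_of_windowBdd r M (windowBdd_of_stubs stub_totalCovariance hcw hG r hM)
  refine Summit.QuantumFields.YangMills.Theorems.TunedSequenceExists.Negative.Glue.lowerBound_of_weak
    r hM ⟨θ₀, hθ₀, fun θ hθ hθ' => ?_⟩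
  obtain ⟨sch, n, hshape, hβ, -, hlim⟩ := hw θ hθ hθ'
  exact ⟨sch, n, hshape, hβ, hlim⟩

end Summit.QuantumFields.YangMills.Cruxes.TunedSequenceExists.BlockConditionedCovariance

end
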